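import Literature.IUT.LogThetaLattice.VerticallyCoricLGPKummer
import HarnessLib

/-!
# [IUTchIII] Proposition 3.5 (i), companion: Galois invariants under the Kummer isomorphisms, and the Frobenius-like data
# TRANSPORTED along the Kummer isomorphisms of labeled data — `VerticallyCoricLGPData.ofKummerTransport'` (no hypothesis)

S. Mochizuki, *Inter-universal Teichmüller theory III*, kurims manuscript (May 2020) `paper:url-4b091feeb646`, §3,
Proposition 3.5 (i) p. 103 l. 35 – p. 104 l. 28 (PRIMS offset ≈ +420) [claim: Mochizuki2012, status: disputed] for every
quoted sentence; abc-iut cell, layer L6, seat abc-iut-L6-t4 (typer of record of [IUTchIII] §3; gen 5). Companion of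
`VerticallyCoricLGPKummer.lean` (`VerticallyCoricLGPData.ofKummer`: Prop. 3.5 (i) constructed over the genuine packets by
naturality of the Prop. 3.4 (ii) construction, hypotheses `hcompat` / `hgau` / `hgauInf`).

WHAT IS BUILT.
* "equipped with actions by topological groups when `v ∈ 𝕍^non`" (p. 104 l. 4–5, l. 27): for a `G_v`-EQUIVARIANT Kummer
  isomorphism of labeled data ([IUTchII] Cor. 4.6 (iii) "compatible with the respective `G_v(†Π_v)`-actions") the packet
  transport carries the Galois-invariant part `Ψ_{𝓕_LGP}(^{n,m})^{G_v}_{v,j}` (gen 4's `ΨGal`) ONTO `Ψ_LGP(^{n,∘})^{G_v}_{v,j}` —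
  `map_piIso_galFixed`, **`ofGaussian_ΨGal_map_congr`** (PROVED);
* `kummerTransport κ m v S := S.comap (piIso κ)` — "the submonoid determined, via the isomorphisms …, by the monoid `Ψ_ξ`"
  ([IUTchII] Cor. 3.6 (ii) p. 99): for the Gaussian monoid of a value profile this IS abc-iut-L6-t2's Frobenioid-theoretic
  Gaussian monoid `frobenioidGaussianMonoid κ ξ` BY NAME (`kummerTransport_gaussianMonoid`, `rfl`) `= Ψ^×_{⟨F_l^⋇⟩} · Im(ξ)^ℕ`
  (Cor. 3.6 (iii), `kummerTransport_gaussianMonoid_eq`); `∞`-version `rfl`; the splitting monoid `μ_{2l}^{diag}·ξ^ℕ`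
  transports to the splitting monoid of `κ⁻¹ ∘ ξ` (`kummerTransport_gaussianSplittingMonoid`, PROVED); the Kummer isomorphism
  carries every transported monoid back onto its source (`map_kummerTransport`) — i.e. the hypotheses `hgau` / `hgauInf` /
  `hsplit` of the parent file HOLD for transported data;
* `kummerMember := e⁻¹ ∘ ι ∘ κ` — the member of the log-link's full poly-isomorphism chosen "in a fashion compatible with …"
  (p. 103 l. 43–45); `kummerMember_compat` discharges `hcompat`;
* **`VerticallyCoricLGPData.ofKummerTransport`** (only `hcompat` left) and **`VerticallyCoricLGPData.ofKummerTransport'`**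
  (NO hypothesis): given any coric data, any Kummer isomorphisms of labeled data `κ` and any identifications `e` of the
  𝓕-prime-strip fields, the vertically coric LGP-monoids WITH their Kummer isomorphisms exist over the genuine packets;
  `ofKummerTransport_ΨSplit_map`: the splittings correspond.

HONEST SCOPE as in the parent file: one nonarchimedean fibre; topologies and the `F^{⋊±}_l`-symmetry compatibility not
modelled; inputs (`κ`, `e`, the coric data) are [IUTchII] Cor. 4.5 (iii) / 4.6 (iii) OUTPUTS read at the level of carrier
monoids/fields — edges, not endorsed. No `Prop`-valued definition, no instance, no named fact; nothing here asserts abc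
proved or refuted or takes a side on [IUTchIII] Cor. 3.12; constructed-as-junction ≠ upstream nodes discharged.
-/

noncomputable section

namespace Literature.IUT.LogThetaLattice

open scoped TensorProduct
open PiTensorProduct
open Literature.IUT.HodgeArakelov Literature.AnabelianGeometry.AbsoluteAnabelian

universe v' w w₁ w₂

/-! ### 1. Labelwise transport along a Kummer isomorphism of labeled data: Galois-fixed parts, Gaussian monoids, splittings -/

section TransportLemmas

variable {Vfib : Type v'} {lstar : ℕ}
variable (M : Vfib → Type w₁) [∀ v, CommMonoid (M v)]
variable (Γ : Vfib → Type w₂) [∀ v, Monoid (Γ v)] [∀ v, MulDistribMulAction (Γ v) (M v)]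
variable (Mm : ℤ → Vfib → Type w₁) [∀ m v, CommMonoid (Mm m v)] [∀ m v, MulDistribMulAction (Γ v) (Mm m v)]
variable (κ : ∀ m v, Mm m v ≃* M v)

/-- A `G_v`-EQUIVARIANT Kummer isomorphism of labeled data ([IUTchII] Cor. 4.6 (iii) "compatible with the respective
`G_v(†Π_v)`-actions") carries the `G_v`-fixed part of `∏_{F_l^⋇} Ψ_cns(^{n,m}𝔉_≻)_v` onto that of `∏_{F_l^⋇} Ψ_cns(^{n,∘}𝔇_≻)_v` (gen 4's
`galFixed`). [cite: Mochizuki2012, Prop. 3.5 (i) p.104] [claim: Mochizuki2012, status: disputed] -/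
theorem map_piIso_galFixed (m : ℤ) (v : Vfib) (hκΓ : ∀ (g : Γ v) (x : Mm m v), κ m v (g • x) = g • κ m v x) :
    (galFixed (Mm m) Γ v : Submonoid (Fin lstar → Mm m v)).map (piIso (Fin lstar) (κ m v)).toMonoidHom =
      galFixed M Γ v := by
  ext y
  simp only [Submonoid.mem_map, galFixed, FixedPoints.mem_submonoid]
  constructor
  · rintro ⟨x, hx, rfl⟩ g
    funext j
    change g • κ m v (x j) = κ m v (x j)
    rw [← hκΓ, ← Pi.smul_apply g x j, hx g]
  · intro hy
    refine ⟨(piIso (Fin lstar) (κ m v)).symm y, fun g => ?_, MulEquiv.apply_symm_apply _ _⟩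
    funext j
    apply (κ m v).injective
    change κ m v (g • (κ m v).symm (y j)) = κ m v ((κ m v).symm (y j))
    rw [hκΓ, MulEquiv.apply_symm_apply, ← Pi.smul_apply g y j, hy g]

/-- "the submonoid determined, via the isomorphisms …, by the monoid `Ψ_ξ`" ([IUTchII] Cor. 3.6 (ii) p. 99, abc-iut-L6-t2's
`frobenioidGaussianMonoid` shape): a coric submonoid `S ⊆ ∏_{F_l^⋇} M_v` pulled back to `∏_{F_l^⋇} Mm_{m,v}` along the labelwise
Kummer isomorphism `piIso κ`. [cite: Mochizuki2012, Prop. 3.5 (i) p.104] [claim: Mochizuki2012, status: disputed] -/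
def kummerTransport (m : ℤ) (v : Vfib) (S : Submonoid (Fin lstar → M v)) : Submonoid (Fin lstar → Mm m v) :=
  S.comap (piIso (Fin lstar) (κ m v)).toMonoidHom

/-- The Kummer isomorphism carries the transported monoid back ONTO `S` (so §3's `hgau`/`hgauInf`/`hsplit` hold for transported
data). [cite: Mochizuki2012, Prop. 3.5 (i) p.104] [claim: Mochizuki2012, status: disputed] -/
theorem map_kummerTransport (m : ℤ) (v : Vfib) (S : Submonoid (Fin lstar → M v)) :
    (kummerTransport M Mm κ m v S).map (piIso (Fin lstar) (κ m v)).toMonoidHom = S :=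
  Submonoid.map_comap_eq_of_surjective (piIso (Fin lstar) (κ m v)).surjective S

/-- Transport is monotone (splitting `≤` Gaussian monoid is preserved). [cite: Mochizuki2012, Prop. 3.5 (i) p.104]
[claim: Mochizuki2012, status: disputed] -/
theorem kummerTransport_mono (m : ℤ) (v : Vfib) {S T : Submonoid (Fin lstar → M v)} (h : S ≤ T) :
    kummerTransport M Mm κ m v S ≤ kummerTransport M Mm κ m v T :=
  Submonoid.monotone_comap h

/-- **Junction BY NAME with [IUTchII] Cor. 3.6 (ii)** (abc-iut-L6-t2): the transport of the Gaussian monoid `Ψ_ξ` of a value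
profile IS the Frobenioid-theoretic Gaussian monoid `Ψ_{𝓕_ξ}` (`frobenioidGaussianMonoid κ ξ`). `rfl`.
[cite: Mochizuki2012, Prop. 3.5 (i) p.104] [claim: Mochizuki2012, status: disputed] -/
theorem kummerTransport_gaussianMonoid (m : ℤ) (v : Vfib) (ξ : Fin lstar → M v) :
    kummerTransport M Mm κ m v (gaussianMonoid ξ) = frobenioidGaussianMonoid (κ m v) ξ := rfl

/-- … `= Ψ^×_{⟨F_l^⋇⟩} · Im(ξ)^ℕ` ([IUTchII] Cor. 3.6 (iii), abc-iut-L6-t2's `frobenioidGaussianMonoid_eq`): the Frobenius-like Gaussian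
monoid is the Gaussian monoid of the transported value profile `κ⁻¹ ∘ ξ`. [cite: Mochizuki2012, Prop. 3.5 (i) p.104]
[claim: Mochizuki2012, status: disputed] -/
theorem kummerTransport_gaussianMonoid_eq (m : ℤ) (v : Vfib) (ξ : Fin lstar → M v) :
    kummerTransport M Mm κ m v (gaussianMonoid ξ) = gaussianMonoid (fun t => (κ m v).symm (ξ t)) :=
  frobenioidGaussianMonoid_eq (κ m v) ξ

/-- `∞`-version: the transport of `∞Ψ_ξ` IS abc-iut-L6-t2's `inftyFrobenioidGaussianMonoid κ ξ`. `rfl`.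
[cite: Mochizuki2012, Prop. 3.5 (i) p.104] [claim: Mochizuki2012, status: disputed] -/
theorem kummerTransport_inftyGaussianMonoid (m : ℤ) (v : Vfib) (ξ : Fin lstar → M v) :
    kummerTransport M Mm κ m v (inftyGaussianMonoid ξ) = inftyFrobenioidGaussianMonoid (κ m v) ξ := rfl

/-- The transported SPLITTING monoid `μ_{2l}^{diag} · ξ^ℕ` ([IUTchII] Cor. 3.5 (iii), abc-iut-L6-t2's `gaussianSplittingMonoid`) is the
splitting monoid of the transported value profile (roots of unity and powers are preserved by `κ⁻¹`). PROVED.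
[cite: Mochizuki2012, Prop. 3.5 (i) p.104] [claim: Mochizuki2012, status: disputed] -/
theorem kummerTransport_gaussianSplittingMonoid (m : ℤ) (v : Vfib) (twoL : ℕ) (ξ : Fin lstar → M v) :
    kummerTransport M Mm κ m v (gaussianSplittingMonoid (M v) twoL ξ) =
      gaussianSplittingMonoid (Mm m v) twoL (fun t => (κ m v).symm (ξ t)) := by
  ext x
  unfold kummerTransport
  rw [Submonoid.mem_comap, mem_gaussianSplittingMonoid_iff, mem_gaussianSplittingMonoid_iff]
  constructor
  · rintro ⟨ω, hω, n, hx⟩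
    refine ⟨Units.map (κ m v).symm.toMonoidHom ω, ?_, n, ?_⟩
    · rw [mem_rootsOfUnity] at hω ⊢
      rw [← map_pow, hω, map_one]
    · funext t
      have ht := congrFun hx t
      simp only [MulEquiv.toMonoidHom_eq_coe, MonoidHom.coe_coe, piIso, MulEquiv.piCongrRight_apply] at ht
      apply (κ m v).injective
      simp [ht]
  · rintro ⟨ω, hω, n, rfl⟩
    refine ⟨Units.map (κ m v).toMonoidHom ω, ?_, n, ?_⟩
    · rw [mem_rootsOfUnity] at hω ⊢
      rw [← map_pow, hω, map_one]
    · funext t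
      simp [piIso]

end TransportLemmas

section Transport

variable (p : ℕ) [Fact p.Prime] {Vfib : Type v'} [Fintype Vfib]
variable (K : Vfib → Type w) [∀ v, NontriviallyNormedField (K v)] [∀ v, Algebra ℚ_[p] (K v)]
  [∀ v, IsBoundedSMul ℚ_[p] (K v)] [∀ v, IsUltrametricDist (K v)] [∀ v, CharZero (K v)]
variable (Lg : ∀ v, PadicLogOnUnits (K v))
variable (Km : ℤ → Vfib → Type w) [∀ m v, NontriviallyNormedField (Km m v)] [∀ m v, Algebra ℚ_[p] (Km m v)]
  [∀ m v, IsBoundedSMul ℚ_[p] (Km m v)] [∀ m v, IsUltrametricDist (Km m v)] [∀ m v, CharZero (Km m v)]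
variable (Lgm : ∀ m v, PadicLogOnUnits (Km m v))
variable {lstar : ℕ} (isBad : Vfib → Prop)
variable (M : Vfib → Type w₁) [∀ v, CommMonoid (M v)]
variable (Γ : Vfib → Type w₂) [∀ v, Monoid (Γ v)] [∀ v, MulDistribMulAction (Γ v) (M v)]
variable (ι : ∀ v, M v →* K v)
variable (gau gauInf : ∀ v, Submonoid (Fin lstar → M v))
variable (split : ∀ v, isBad v → Submonoid (Fin lstar → M v))
variable (split_le : ∀ v (h : isBad v), split v h ≤ gau v)
variable (Mm : ℤ → Vfib → Type w₁) [∀ m v, CommMonoid (Mm m v)] [∀ m v, MulDistribMulAction (Γ v) (Mm m v)]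
variable (κ : ∀ m v, Mm m v ≃* M v) (e : ∀ m v, Km m v ≃ₐ[ℚ_[p]] K v)
variable (ιm : ∀ m v, Mm m v →* Km m v)
variable (gaum gauInfm : ∀ m v, Submonoid (Fin lstar → Mm m v))
variable (splitm : ∀ m v, isBad v → Submonoid (Fin lstar → Mm m v))
variable (splitm_le : ∀ m v (h : isBad v), splitm m v h ≤ gaum m v)

/-! ### 2. "equipped with actions by topological groups when `v ∈ 𝕍^non`": the Galois invariants correspond -/

/-- **"equipped with actions by topological groups when `v ∈ 𝕍^non`"** (p. 104 l. 4–5, l. 27): for a `G_v`-equivariant Kummer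
isomorphism of labeled data the packet transport carries the Galois-invariant part `Ψ_{𝓕_LGP}(^{n,m})^{G_v}_{v,j}` (gen 4's
`ΨGal` = component of `Ψ_{𝓕gau} ⊓ (∏ M)^{G_v}`) ONTO `Ψ_LGP(^{n,∘})^{G_v}_{v,j}`. PROVED. [cite: Mochizuki2012, Prop. 3.5 (i) p.104]
[claim: Mochizuki2012, status: disputed] -/
theorem ofGaussian_ΨGal_map_congr (m : ℤ) (hcompat : ∀ v x, e m v (ιm m v x) = ι v (κ m v x))
    (hgau : ∀ v, (gaum m v).map (piIso (Fin lstar) (κ m v)).toMonoidHom = gau v)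
    (hκΓ : ∀ v (g : Γ v) (x : Mm m v), κ m v (g • x) = g • κ m v x) (v : Vfib) (j : Fin lstar) :
    ((LGPMonoidSignature.ofGaussian p (Km m) (Lgm m) isBad (Mm m) Γ (ιm m) (gaum m) (gauInfm m)
        (splitm m) (splitm_le m)).ΨGal v j).map (lgpPacketCongr p K (Km m) (e m) v j).toMulEquiv =
      (LGPMonoidSignature.ofGaussian p K Lg isBad M Γ ι gau gauInf split split_le).ΨGal v j := by
  change (lgpComponent p (Km m) (Mm m) (ιm m) v (gaum m v ⊓ galFixed (Mm m) Γ v) j).map _ =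
    lgpComponent p K M ι v (gau v ⊓ galFixed M Γ v) j
  rw [map_lgpComponent_congr p K (Km m) M ι (Mm m) (ιm m) (κ m) (e m) hcompat,
    Submonoid.map_inf _ _ (piIso (Fin lstar) (κ m v)).toMonoidHom (piIso (Fin lstar) (κ m v)).injective, hgau,
    map_piIso_galFixed M Γ Mm κ m v (hκΓ v)]

/-! ### 3. The construction with the transported data and the compatible member: no hypothesis left -/


omit [Fintype Vfib] [∀ v, IsBoundedSMul ℚ_[p] (K v)] [∀ v, IsUltrametricDist (K v)] [∀ v, CharZero (K v)]
  [∀ m v, IsBoundedSMul ℚ_[p] (Km m v)] [∀ m v, IsUltrametricDist (Km m v)] [∀ m v, CharZero (Km m v)] in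
/-- **The compatible member** of the log-link `(n,m−1) → (n,m)`'s full poly-isomorphism (p. 103 l. 43–45 "which we consider in a
fashion compatible with …"): `ι_m := e_m⁻¹ ∘ ι ∘ κ_m : Ψ_cns(^{n,m}𝔉_≻)_v → log(^{n,m−1}𝓕_v)` — the full poly-isomorphism contains
every isomorphism of 𝓕-prime-strips, in particular this one. [cite: Mochizuki2012, Prop. 3.5 (i) p.103]
[claim: Mochizuki2012, status: disputed] -/
def kummerMember (m : ℤ) (v : Vfib) : Mm m v →* Km m v :=
  (((e m v).symm : K v ≃ₐ[ℚ_[p]] Km m v) : K v →* Km m v).comp ((ι v).comp (κ m v).toMonoidHom)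

omit [Fintype Vfib] [∀ v, IsBoundedSMul ℚ_[p] (K v)] [∀ v, IsUltrametricDist (K v)] [∀ v, CharZero (K v)]
  [∀ m v, IsBoundedSMul ℚ_[p] (Km m v)] [∀ m v, IsUltrametricDist (Km m v)] [∀ m v, CharZero (Km m v)] in
/-- The compatible member IS compatible: `e_m ∘ ι_m = ι ∘ κ_m` (§3's `hcompat` discharged). [cite: Mochizuki2012, Prop. 3.5 (i) p.103]
[claim: Mochizuki2012, status: disputed] -/
theorem kummerMember_compat (m : ℤ) (v : Vfib) (x : Mm m v) :
    e m v (kummerMember p K Km M ι Mm κ e m v x) = ι v (κ m v x) :=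
  (e m v).apply_symm_apply _

/-- **Prop. 3.5 (i) at the TRANSPORTED Frobenius-like data** — `Ψ_{𝓕gau}(^{n,m}) :=` the coric Gaussian data pulled back along
`κ_m` (for value profiles: abc-iut-L6-t2's [IUTchII] Cor. 3.6 (ii) `frobenioidGaussianMonoid`, `kummerTransport_gaussianMonoid`),
likewise `∞Ψ` and the splittings: the ONLY remaining hypothesis is the compatibility of the chosen log-link members.
[cite: Mochizuki2012, Prop. 3.5 (i) p.103] [claim: Mochizuki2012, status: disputed] -/
def VerticallyCoricLGPData.ofKummerTransport (ιm : ∀ m v, Mm m v →* Km m v)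
    (hcompat : ∀ m v x, e m v (ιm m v x) = ι v (κ m v x)) :
    VerticallyCoricLGPData lstar Vfib isBad (fun v j => LGPPacket p K v j) (fun m v j => LGPPacket p (Km m) v j) :=
  VerticallyCoricLGPData.ofKummer p K Lg Km Lgm isBad M Γ ι gau gauInf split split_le Mm ιm
    (fun m v => kummerTransport M Mm κ m v (gau v)) (fun m v => kummerTransport M Mm κ m v (gauInf v))
    (fun m v h => kummerTransport M Mm κ m v (split v h)) (fun m v h => kummerTransport_mono M Mm κ m v (split_le v h))
    κ e hcompat (fun m v => map_kummerTransport M Mm κ m v (gau v)) (fun m v => map_kummerTransport M Mm κ m v (gauInf v))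

/-- **Prop. 3.5 (i) with NO hypothesis**: transported Gaussian data and the compatible member `kummerMember`. Given ANY coric
data, ANY Kummer isomorphisms of labeled data `κ` and ANY identifications `e` of the 𝓕-prime-strip fields, the vertically coric
LGP-monoids with their Kummer isomorphisms exist over the genuine packets — the output signature of record is inhabited by the
printed construction, not only by the trivial witness of `nonempty_verticallyCoricLGPData`. [cite: Mochizuki2012, Prop. 3.5 (i) p.103]
[claim: Mochizuki2012, status: disputed] -/
def VerticallyCoricLGPData.ofKummerTransport' :
    VerticallyCoricLGPData lstar Vfib isBad (fun v j => LGPPacket p K v j) (fun m v j => LGPPacket p (Km m) v j) :=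
  VerticallyCoricLGPData.ofKummerTransport p K Lg Km Lgm isBad M Γ ι gau gauInf split split_le Mm κ e
    (kummerMember p K Km M ι Mm κ e) (kummerMember_compat p K Km M ι Mm κ e)

/-- "splittings [up to torsion, when `v ∈ 𝕍^bad`]" for the transported data: at a bad `v` the Kummer isomorphism (= packet
transport) carries the index-`m` splitting monoid `Ψ^⊥_{𝓕_LGP}(^{n,m})_{v,j}` ONTO the coric `Ψ^⊥_LGP(^{n,∘})_{v,j}` (= the field
`ΨcoricSplit` of `ofKummerTransport`). PROVED. [cite: Mochizuki2012, Prop. 3.5 (i) p.104] [claim: Mochizuki2012, status: disputed] -/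
theorem VerticallyCoricLGPData.ofKummerTransport_ΨSplit_map (ιm : ∀ m v, Mm m v →* Km m v)
    (hcompat : ∀ m v x, e m v (ιm m v x) = ι v (κ m v x)) (m : ℤ) {v : Vfib} (h : isBad v) (j : Fin lstar) :
    ((LGPMonoidSignature.ofGaussian p (Km m) (Lgm m) isBad (Mm m) Γ (ιm m)
        (fun v => kummerTransport M Mm κ m v (gau v)) (fun v => kummerTransport M Mm κ m v (gauInf v))
        (fun v h => kummerTransport M Mm κ m v (split v h))
        (fun v h => kummerTransport_mono M Mm κ m v (split_le v h))).ΨSplit v h j).map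
        (lgpPacketCongr p K (Km m) (e m) v j).toMulEquiv =
      (LGPMonoidSignature.ofGaussian p K Lg isBad M Γ ι gau gauInf split split_le).ΨSplit v h j :=
  ofGaussian_ΨSplit_map_congr p K Lg Km Lgm isBad M Γ ι gau gauInf split split_le Mm ιm
    (fun m v => kummerTransport M Mm κ m v (gau v)) (fun m v => kummerTransport M Mm κ m v (gauInf v))
    (fun m v h => kummerTransport M Mm κ m v (split v h))
    (fun m v h => kummerTransport_mono M Mm κ m v (split_le v h)) κ e m (hcompat m) h
    (map_kummerTransport M Mm κ m v (split v h)) j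

end Transport

end Literature.IUT.LogThetaLattice

end
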